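import Literature.AlgebraicGeometry.Frobenioids.RealSpanKernel
import HarnessLib

/-!
# Frobenioids I, Thm. 5.1 (i) / Prop. 5.3 / Thm. 6.4 (i): `Pic` of THE realification — `ι^gp` is injective,
# degrees descend to `Pic`, and `(ℝ_{≥0})^gp = ℝ`

Mochizuki, *The geometry of Frobenioids I*, Kyushu J. Math. **62** (2008): Thm. 5.1 p. 96 (`Pic_Φ(A) := Φ^gp(A)/Φ^birat(A)`),
Prop. 5.3 p. 103 (`ℝ · Φ^birat ⊆ (Φ^rlf)^gp`), Thm. 6.4 (i) p. 115 l. 27–33 (the degree `(Φ^rlf)^gp(L) → ℝ` factors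
through `Pic_Φ(A)`, `A` Frobenius-trivial over `Spec L`: "`δ_A : Pic_Φ(A) ⥲ ℝ`") [cite: MochizukiFrdI2008, Thm. 6.4 (i) p.115]
[cite: MochizukiFrdI2008, Prop. 5.3 p.103].

PROOF-ONLY pieces of the `δ`-side of THE realified arithmetic Frobenioid (the `ArithRealification` interface,
seat abc-iut-L1-t3/t1; holder abc-iut-L6-t10):
* `RealificationData.canonical_toRlfGp_injective` — `ι^gp : Φ(X)^gp ↪ (Φ^rlf)^gp(X)` is injective for THE data
  (so `Φ^birat(X)` is viewed faithfully inside `(Φ^rlf)^gp(X)`);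
* `RealificationData.existsUnique_picLift` — a homomorphism out of `(Φ^rlf)^gp(X)` killing `(ℝ · Ψ)(X)` descends
  UNIQUELY to `Pic = (Φ^rlf)^gp(X)/(ℝ · Ψ)(X)` (with `RealSpanKernel.canonical_realSpan_le_ker`: degrees descend);
* `nnrealGp_lift_bijective` — `(ℝ_{≥0})^gp ≅ ℝ`: the canonical `(ℝ_{≥0})^gp → ℝ`, `[a]/[b] ↦ a − b`, is bijective
  (so a descended `ℝ_{≥0}`-valued degree is an `ℝ`-valued `δ`).
Seat abc-iut-L1-d2 (cell abc-iut).
-/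

noncomputable section

namespace Literature.AlgebraicGeometry.Frobenioids

open CategoryTheory Opposite Function NNReal Literature.AnabelianGeometry.EtaleTheta

universe v u

/-! ### `(ℝ_{≥0})^gp = ℝ` -/

/-- **`(ℝ_{≥0})^gp ≅ ℝ`**: the homomorphism `(ℝ_{≥0})^gp → ℝ` induced by the inclusion `ℝ_{≥0} ⊆ ℝ`
(`[a]/[b] ↦ a − b`) is bijective. [cite: MochizukiFrdI2008, Thm. 6.4 (i) p.115] -/
theorem nnrealGp_lift_bijective :
    Bijective (Algebra.GrothendieckGroup.lift
      (NNReal.toRealHom.toAddMonoidHom.toMultiplicative : Multiplicative ℝ≥0 →* Multiplicative ℝ)) := by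
  set ψ : Multiplicative ℝ≥0 →* Multiplicative ℝ := NNReal.toRealHom.toAddMonoidHom.toMultiplicative with hψ
  have hlift_of : ∀ a : Multiplicative ℝ≥0,
      Algebra.GrothendieckGroup.lift ψ (Algebra.GrothendieckGroup.of a) = ψ a := fun a =>
    DFunLike.congr_fun (Algebra.GrothendieckGroup.lift.symm_apply_apply ψ) a
  have hψ_apply : ∀ a : Multiplicative ℝ≥0, Multiplicative.toAdd (ψ a) = ((Multiplicative.toAdd a : ℝ≥0) : ℝ) :=
    fun _ => rfl
  constructor
  · rw [injective_iff_map_eq_one]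
    intro z hz
    obtain ⟨⟨a, b⟩, hab⟩ := (Localization.monoidOf (⊤ : Submonoid (Multiplicative ℝ≥0))).surj z
    have hab' : z * Algebra.GrothendieckGroup.of (b : Multiplicative ℝ≥0) = Algebra.GrothendieckGroup.of a := hab
    have h := congrArg (Algebra.GrothendieckGroup.lift ψ) hab'
    rw [map_mul, hz, one_mul, hlift_of, hlift_of] at h
    have hba : (b : Multiplicative ℝ≥0) = a := by
      have := congrArg Multiplicative.toAdd h
      rw [hψ_apply, hψ_apply] at this
      exact Multiplicative.toAdd.injective (NNReal.coe_injective this)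
    rw [hba] at hab'
    exact mul_eq_right.mp hab'
  · intro y
    refine ⟨Algebra.GrothendieckGroup.of (Multiplicative.ofAdd (Multiplicative.toAdd y).toNNReal) /
        Algebra.GrothendieckGroup.of (Multiplicative.ofAdd (-Multiplicative.toAdd y).toNNReal), ?_⟩
    rw [map_div, hlift_of, hlift_of]
    apply Multiplicative.toAdd.injective
    rw [toAdd_div, hψ_apply, hψ_apply, toAdd_ofAdd, toAdd_ofAdd, Real.coe_toNNReal', Real.coe_toNNReal',
      max_zero_sub_max_neg_zero_eq_self]

namespace RealificationData

variable {D : Type u} [Category.{v} D]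

/-! ### `ι^gp : Φ^gp → (Φ^rlf)^gp` is injective for THE data -/

/-- **`ι^gp : Φ(X)^gp → (Φ^rlf)^gp(X)` is injective** for THE realification data (`Φ(X) → Φ(X)^rlf` is injective and
`Φ(X)^rlf` is cancellative). [cite: MochizukiFrdI2008, Prop. 5.3 p.103] -/
theorem canonical_toRlfGp_injective {Φ : Dᵒᵖ ⥤ CommMonCat.{u}} (hΦ : ∀ X : Dᵒᵖ, IsPerfFactorial (Φ.obj X))
    (X : D) : Injective ((canonical Φ hΦ).toRlfGp X) := by
  haveI : IsCancelMul ((canonical Φ hΦ).rlf.obj (op X)) := IsPerfFactorial.Rlf.isCancelMul (hΦ (op X))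
  -- the underlying `Φ(X) → Φ(X)^rlf` is injective
  have hinj : Injective ((canonical Φ hΦ).toRlf.app (op X)).hom := by
    intro a b hab
    have h1 : (hΦ (op X)).toRealification (Perfection.of _ a) = (hΦ (op X)).toRealification (Perfection.of _ b) := by
      rw [canonical_toRlf] at hab
      exact hab
    exact of_injective_of_isSharp_isIntegral_isSaturated (hΦ (op X)).isDivisorial.isSharp
      (hΦ (op X)).isDivisorial.isPreDivisorial.isIntegral (hΦ (op X)).isDivisorial.isPreDivisorial.isSaturated
      ((hΦ (op X)).factorMap_injective (congrArg Subtype.val h1))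
  -- groupification preserves injectivity into a cancellative monoid
  rw [injective_iff_map_eq_one]
  intro z hz
  obtain ⟨⟨a, b⟩, hab⟩ := (Localization.monoidOf (⊤ : Submonoid (Φ.obj (op X)))).surj z
  have hab' : z * Algebra.GrothendieckGroup.of (b : Φ.obj (op X)) = Algebra.GrothendieckGroup.of a := hab
  have h := congrArg ((canonical Φ hΦ).toRlfGp X) hab'
  rw [map_mul, hz, one_mul] at h
  change MonGp.map _ _ = MonGp.map _ _ at h
  rw [MonGp.map_of, MonGp.map_of] at h
  have hba : (b : Φ.obj (op X)) = a := hinj (Algebra.GrothendieckGroup.of_injective h)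
  rw [hba] at hab'
  exact mul_eq_right.mp hab'

/-! ### Degrees descend to `Pic` -/

variable {Φ : Dᵒᵖ ⥤ CommMonCat.{u}} (R : RealificationData Φ) (Ψ : GpSubfunctor Φ)

/-- **A homomorphism out of `(Φ^rlf)^gp(X)` killing `(ℝ · Ψ)(X)` descends uniquely to
`Pic = (Φ^rlf)^gp(X)/(ℝ · Ψ)(X)`** (for THE data and a degree killing `ι(Ψ)`, the hypothesis is
`RealSpanKernel.canonical_realSpan_le_ker`). [cite: MochizukiFrdI2008, Thm. 6.4 (i) p.115] -/
theorem existsUnique_picLift (X : D) {G : Type*} [CommGroup G]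
    (Dg : Algebra.GrothendieckGroup (R.rlf.obj (op X)) →* G) (hker : (R.realSpan Ψ).carrier X ≤ Dg.ker) :
    ∃! δ : (R.realSpan Ψ).Pic X →* G, δ.comp (QuotientGroup.mk' ((R.realSpan Ψ).carrier X)) = Dg := by
  refine ⟨QuotientGroup.lift _ Dg hker, QuotientGroup.lift_comp_mk' _ _ hker, fun δ hδ => ?_⟩
  apply QuotientGroup.monoidHom_ext
  rw [hδ, QuotientGroup.lift_comp_mk']

end RealificationData

end Literature.AlgebraicGeometry.Frobenioids
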